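import Literature.NumberTheory.LFunctions.MatomakiRadziwillTaoPropA3WindowSq
import Literature.NumberTheory.LFunctions.HalaszRestrictedWindowSqConst
import Literature.NumberTheory.LFunctions.HalaszRestrictedSharp
import Literature.NumberTheory.LFunctions.VinogradovZetaSumEstimate
import Mathlib.NumberTheory.Chebyshev
import HarnessLib

/-!
# Matomäki–Radziwiłł–Tao (2015), Proposition A.3: the window around the minimiser in `L²`, with the PRINTED middle term

Topic `Literature/NumberTheory/LFunctions`.  Everything in this file is PROVED; no definitions, no named facts.

Companion of `MatomakiRadziwillTaoPropA3WindowSq.lean` (tree), which bounds the contribution of the window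
`|t - t₁| ≤ (log X)^{1/16}` to `∫ |F(1+it)|²` (`F` the `𝒮`-restricted polynomial of Proposition A.3, `f` completely
multiplicative) by `K((1+M)² e^{-M} + (log X)^{-1/50})` through Gallagher's lemma and the window form of the restricted
Halász theorem (main term `(1+M_½)e^{-M_½}`, entering squared).  Here the window theorem WITHOUT the polynomial factor
(`Halasz.Restricted.norm_restr_interval_sum_le_sharp`, `HalaszRestrictedSharp.lean`, main term `e^{-M/2}` in the regime
`34M + C_r ≤ log log x`, from the Vinogradov–Korobov region of the tree `VKZeta.exists_hasVKZeroFreeRegion`) is fed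
into the same Gallagher argument (`Halasz.Restricted.integral_sq_restr_dirichlet_window_sq_le_of_const`,
`HalaszRestrictedWindowSqConst.lean`); outside the regime the unconditional window theorem
`Halasz.Restricted.norm_restr_interval_sum_le` suffices, its squared main term `(1+M)²e^{-M}` being then
`≪ (log X)^{-1/50}`.  The result, `MRT2015.integral_sq_restr_window_le_exp`, is the window bound of Proposition A.3
with the middle term `e^{-M}` (`≤ (1+M)e^{-M}`, AS PRINTED, indeed better) for completely multiplicative `g`, in the
generality needed by the reduction of multiplicative to completely multiplicative functions
(`MatomakiRadziwillTaoPropA3WindowMult.lean`): the restricted sum may be taken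

* over ANY sub-family `𝓙 ⊆ [1, J]` of the blocks `[P_j, Q_j]` of the interval system `I : SieveIntervalSystem η X₀`
  (`√X ≤ X₀ ≤ X`),
* at ANY scale `Y ∈ [X (log X)^{-1/4}, X]` (the sum over `Y ≤ n ≤ 2Y`),

while the window `[a, b] ⊆ [t₁ - 2(log X)^{1/16}, t₁ + 2(log X)^{1/16}] ∩ [-X/2, X/2]` (twice the printed width, which
is free), the near-minimiser `t₁` (`𝔻(g, n^{it₁}; X)² ≤ M + 1`, `M = M(g; X) = min_{|u| ≤ X} 𝔻(g, n^{iu}; X)²`; in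
Proposition A.3 `t₁` is the minimiser) and the main term `e^{-M}` all refer to the scale `X`:

`∫_a^b |∑_{Y ≤ n ≤ 2Y, n ∈ 𝒮(𝓙)} g(n) n^{-1-it}|² dt ≤ K (e^{-M} + (log X)^{-1/50})`.

Also: the twist/height comparison lemmas `Halasz.Restricted.minPretentiousDistSq_le_twist`,
`…minHalfDistSq_twist_ge_half_min'`, `…minPretentiousDistSq_twist_le`, the Chebyshev prime tail
`…sum_inv_prime_Ioc_le_theta` (`∑_{y < p ≤ X} 1/p ≤ (log 4) X/(y log y)`, from Mathlib's `θ(x) ≤ (log 4) x`) and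
`…minPretentiousDistSq_le_height_add` (`M(X, T) ≤ M(y, T) + 2 (log 4) X/(y log y)`).

## References
* K. Matomäki, M. Radziwiłł, T. Tao, *An averaged form of Chowla's conjecture*, Algebra & Number Theory 9 (2015),
  Appendix A, Proposition A.3 and its proof (the ranges `𝒯₀`, `𝒯₁`; `t₁` the minimiser of `M(f;X)`).
  [cite: MatomakiRadziwillTao2015, Appendix A, Proposition A.3 (proof)]
* A. Granville, K. Soundararajan, Canad. J. Math. 55 (2003) (the method). [cite: GranvilleSoundararajan2003, Theorem 1]

## Design choices
* Same parameters as `MRT2015.integral_sq_restrDirichlet_window_le_sq` (`δ₀ = e^{-(λ/16 + λ/100)}`, `Q = exp(√log X)`,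
  `λ = log log X`) with the Gallagher window `L_w = 2(log X)^{1/16}` and the twist range `Y/4`; the error bookkeeping is
  the tree's `MRT2015.windowSq_errTerms_le` (used once, doubled); constants existential.
* The two regimes are merged inside the abstract main term `A₀ = e·e^{-M/2} + B`, `B = 0` in the regime and
  `B = (1+M₀)e^{-M₀}`, `M₀ = max(0, M/2 - 1)`, outside, so that Gallagher's lemma is invoked once.
-/

noncomputable section

open Finset Real Complex Filter MeasureTheory
open scoped ComplexConjugate Classical

namespace Literature.NumberTheory.LFunctions

namespace Halasz

namespace Restricted

variable {g : ℕ → ℂ}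

/-- `𝔻(g n^{-is}, n^{iu}; y)² = 𝔻(g, n^{i(s+u)}; y)²`. [folklore] -/
theorem pretentiousDistSq_mul_twist (g : ℕ → ℂ) (s u y : ℝ) :
    Sieve.pretentiousDistSq (fun n : ℕ => g n * (n : ℂ) ^ (-((s : ℂ) * I))) (fun n : ℕ => (n : ℂ) ^ ((u : ℂ) * I)) y =
      Sieve.pretentiousDistSq g (fun n : ℕ => (n : ℂ) ^ (((s + u : ℝ) : ℂ) * I)) y := by
  unfold Sieve.pretentiousDistSq
  refine Finset.sum_congr rfl fun p hp => ?_
  rw [Nat.mem_primesLE] at hp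
  rw [mul_cpow_neg_mul_conj_cpow hp.2.pos]

/-- For `|t₁| + T' ≤ X` (`T' ≥ 0`): `M(y, X) ≤ M(g n^{-it₁}; y, T')` (the twists `n^{i(t₁+u)}`, `|u| ≤ T'`, stay in
`|t| ≤ X`). [folklore] -/
theorem minPretentiousDistSq_le_twist (hgb : ∀ n, ‖g n‖ ≤ 1) {X T' t₁ : ℝ} (hT' : 0 ≤ T')
    (ht₁ : |t₁| + T' ≤ X) (y : ℝ) :
    Sieve.minPretentiousDistSq g y X ≤
      Sieve.minPretentiousDistSq (fun n : ℕ => g n * (n : ℂ) ^ (-((t₁ : ℂ) * I))) y T' := by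
  have hne : Nonempty (Set.Icc (-T') T') := ⟨⟨0, by simp [hT']⟩⟩
  unfold Sieve.minPretentiousDistSq
  refine le_ciInf fun u => ?_
  rw [pretentiousDistSq_mul_twist]
  have hu : |(u : ℝ)| ≤ T' := abs_le.2 ⟨u.2.1, u.2.2⟩
  have htu : |t₁ + (u : ℝ)| ≤ X := by have := abs_add_le t₁ (u : ℝ); linarith
  exact minPretentiousDistSq_le_of_abs_le hgb y htu

/-- For `|t| + T' ≤ X` (`T' ≥ 0`): `M(y, X)/2 ≤ M_½(E, g n^{-it}; y, T')` (cf. `minHalfDistSq_twist_ge_half_min_quarter`).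
[folklore] -/
theorem minHalfDistSq_twist_ge_half_min' (hgb : ∀ n, ‖g n‖ ≤ 1) (E : Finset ℕ) {X T' t : ℝ} (hT' : 0 ≤ T')
    (ht : |t| + T' ≤ X) (y : ℝ) :
    Sieve.minPretentiousDistSq g y X / 2 ≤
      minHalfDistSq E (fun n : ℕ => g n * (n : ℂ) ^ (-((t : ℂ) * I))) y T' := by
  have hne : Nonempty (Set.Icc (-T') T') := ⟨⟨0, by simp [hT']⟩⟩
  unfold minHalfDistSq
  refine le_ciInf fun u => ?_
  rw [halfDistSq_mul_twist]
  have hu : |(u : ℝ)| ≤ T' := abs_le.2 ⟨u.2.1, u.2.2⟩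
  have htu : |t + (u : ℝ)| ≤ X := by
    have := abs_add_le t (u : ℝ); linarith
  have h1 := minPretentiousDistSq_le_of_abs_le hgb y htu
  have h2 := halfDistSq_ge_half hgb E (t + (u : ℝ)) y
  linarith

/-- For `X ≥ 4`, `y ≤ 4X`, `T' ≥ 0`: `M(g n^{-it₁}; y, T') ≤ 𝔻(g, n^{it₁}; X)² + 10` (twist `u = 0`, heights `y ≤ 4X`,
`2 ∑_{X < p ≤ 4X} 1/p ≤ 10`). [folklore] -/
theorem minPretentiousDistSq_twist_le (hgb : ∀ n, ‖g n‖ ≤ 1) {X y T' t₁ : ℝ} (hX : 4 ≤ X) (hy : y ≤ 4 * X)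
    (hT' : 0 ≤ T') :
    Sieve.minPretentiousDistSq (fun n : ℕ => g n * (n : ℂ) ^ (-((t₁ : ℂ) * I))) y T' ≤
      Sieve.pretentiousDistSq g (fun n : ℕ => (n : ℂ) ^ ((t₁ : ℂ) * I)) X + 10 := by
  have hgt : ∀ n, ‖(fun n : ℕ => g n * (n : ℂ) ^ (-((t₁ : ℂ) * I))) n‖ ≤ 1 := norm_mul_twist_le hgb t₁
  have h1 := minPretentiousDistSq_le_of_abs_le hgt y (T := T') (t := 0) (by rw [abs_zero]; exact hT')
  rw [pretentiousDistSq_mul_twist] at h1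
  simp only [add_zero] at h1
  have hw : ∀ n : ℕ, ‖(fun n : ℕ => (n : ℂ) ^ ((t₁ : ℂ) * I)) n‖ ≤ 1 :=
    fun n => norm_natCast_cpow_le_one_of_re_eq_zero (by simp) n
  have h2 : Sieve.pretentiousDistSq g (fun n : ℕ => (n : ℂ) ^ ((t₁ : ℂ) * I)) y ≤
      Sieve.pretentiousDistSq g (fun n : ℕ => (n : ℂ) ^ ((t₁ : ℂ) * I)) (4 * X) :=
    Sieve.pretentiousDistSq_mono hgb hw hy
  have h3 := Sieve.HalaszMT.pretentiousDistSq_le_add_tail hgb hw (by linarith : X ≤ 4 * X) (g := g)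
    (w := fun n : ℕ => (n : ℂ) ^ ((t₁ : ℂ) * I))
  have h4 : ∑ p ∈ (Finset.Ioc ⌊X⌋₊ ⌊4 * X⌋₊).filter Nat.Prime, (1 : ℝ) / p ≤ 5 := by
    refine (sum_inv_prime_Ioc_le (by linarith) (by linarith : X ≤ 4 * X)).trans ?_
    rw [div_le_iff₀ (by linarith)]; linarith
  linarith

/-- **A Chebyshev prime tail**: `∑_{⌊y⌋ < p ≤ ⌊X⌋} 1/p ≤ (log 4) X/(y log y)` for `1 < y ≤ X` (each term is
`≤ log p/(y log y)`, and `∑_{p ≤ X} log p = θ(X) ≤ (log 4) X`, Mathlib's `Chebyshev.theta_le_log4_mul_x`). [folklore] -/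
theorem sum_inv_prime_Ioc_le_theta {y X : ℝ} (hy : 1 < y) (hyX : y ≤ X) :
    ∑ p ∈ (Finset.Ioc ⌊y⌋₊ ⌊X⌋₊).filter Nat.Prime, (1 : ℝ) / p ≤ Real.log 4 * X / (y * Real.log y) := by
  have hy0 : 0 < y := by linarith
  have hlogy : 0 < Real.log y := Real.log_pos hy
  have hX0 : 0 ≤ X := by linarith
  have hterm : ∀ p ∈ (Finset.Ioc ⌊y⌋₊ ⌊X⌋₊).filter Nat.Prime,
      (1 : ℝ) / p ≤ Real.log p / (y * Real.log y) := by
    intro p hp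
    rw [Finset.mem_filter, Finset.mem_Ioc] at hp
    have hyp : y < p := by
      have h1 : (⌊y⌋₊ : ℝ) + 1 ≤ p := by exact_mod_cast hp.1.1
      have h2 : y < ⌊y⌋₊ + 1 := Nat.lt_floor_add_one y
      linarith
    have hp0 : (0 : ℝ) < p := hy0.trans hyp
    have hlogp : Real.log y ≤ Real.log p := Real.log_le_log hy0 hyp.le
    rw [div_le_div_iff₀ hp0 (by positivity)]
    calc 1 * (y * Real.log y) = y * Real.log y := one_mul _
      _ ≤ p * Real.log p := mul_le_mul hyp.le hlogp hlogy.le hp0.le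
      _ = Real.log p * p := mul_comm _ _
  refine (Finset.sum_le_sum hterm).trans ?_
  rw [← Finset.sum_div]
  refine div_le_div_of_nonneg_right ?_ (by positivity)
  have hsub : (Finset.Ioc ⌊y⌋₊ ⌊X⌋₊).filter Nat.Prime ⊆ (Finset.Ioc 0 ⌊X⌋₊).filter Nat.Prime := by
    intro p hp
    rw [Finset.mem_filter, Finset.mem_Ioc] at hp ⊢
    exact ⟨⟨by omega, hp.1.2⟩, hp.2⟩
  have hθ : ∑ p ∈ (Finset.Ioc 0 ⌊X⌋₊).filter Nat.Prime, Real.log (p : ℝ) ≤ Real.log 4 * X := by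
    have := Chebyshev.theta_le_log4_mul_x hX0
    unfold Chebyshev.theta at this
    convert this using 2
  calc ∑ p ∈ (Finset.Ioc ⌊y⌋₊ ⌊X⌋₊).filter Nat.Prime, Real.log (p : ℝ)
      ≤ ∑ p ∈ (Finset.Ioc 0 ⌊X⌋₊).filter Nat.Prime, Real.log (p : ℝ) := by
        refine Finset.sum_le_sum_of_subset_of_nonneg hsub fun p hp _ => ?_
        rw [Finset.mem_filter] at hp
        exact Real.log_nonneg (by exact_mod_cast hp.2.one_lt.le)
    _ ≤ Real.log 4 * X := hθ

/-- **Heights, with the Chebyshev tail**: `M(X, T) ≤ M(y, T) + 2 (log 4) X/(y log y)` for `y > 1` (`T ≥ 0`): for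
`y ≥ X` by monotonicity in the height, for `y < X` by `minPretentiousDistSq_le_add_tail` and
`sum_inv_prime_Ioc_le_theta`. [folklore] -/
theorem minPretentiousDistSq_le_height_add (hgb : ∀ n, ‖g n‖ ≤ 1) {X T y : ℝ} (hT : 0 ≤ T) (hy : 1 < y)
    (hX : 0 ≤ X) :
    Sieve.minPretentiousDistSq g X T ≤
      Sieve.minPretentiousDistSq g y T + 2 * (Real.log 4 * X / (y * Real.log y)) := by
  have hy0 : 0 < y := by linarith
  have htail0 : 0 ≤ Real.log 4 * X / (y * Real.log y) := by
    have : 0 < Real.log 4 := Real.log_pos (by norm_num)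
    have : 0 < Real.log y := Real.log_pos hy
    positivity
  rcases le_or_gt X y with hXy | hyX
  · have := minPretentiousDistSq_mono_height hgb hT hXy (g := g); linarith
  · have h1 := minPretentiousDistSq_le_add_tail hgb hT hyX.le (g := g)
    have h2 := sum_inv_prime_Ioc_le_theta hy hyX.le
    linarith

end Restricted

end Halasz

namespace MRT2015

open Sieve (SieveIntervalSystem minPretentiousDistSq minPretentiousDistSq_nonneg pretentiousDistSq)
open Halasz.Restricted (MemBlocks IsBlockSystem minHalfDistSq)

variable {η X₀ : ℝ}

/-- `√a ≤ √b + 1` when `a ≤ b + 2√b + 1` (`b ≥ 0`). [folklore] -/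
theorem sqrt_le_sqrt_add_one {a b : ℝ} (hb : 0 ≤ b) (h : a ≤ b + 2 * Real.sqrt b + 1) :
    Real.sqrt a ≤ Real.sqrt b + 1 := by
  rw [Real.sqrt_le_left (by positivity)]
  nlinarith [Real.sq_sqrt hb, Real.sqrt_nonneg b]

/-- Outside the regime: if `¬ (34 M + C ≤ λ)` (`M, C ≥ 0`) then `(1 + M)² e^{-M} ≤ 40 e^{C/50} e^{-λ/50}`
(`(1+M)² ≤ 40 e^{16M/50}` and `e^{-34M/50} ≤ e^{(C-λ)/50}`). [folklore] -/
theorem sq_mul_exp_neg_le_of_not_regime {M C lam : ℝ} (hM : 0 ≤ M) (h : ¬ (34 * M + C ≤ lam)) :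
    (1 + M) ^ 2 * Real.exp (-M) ≤ 40 * Real.exp (C / 50) * Real.exp (-(lam / 50)) := by
  push Not at h
  have h1 : (1 + M) ^ 2 ≤ 40 * Real.exp (16 * M / 50) := by
    have hq := Real.quadratic_le_exp_of_nonneg (by positivity : (0:ℝ) ≤ 16 * M / 50)
    nlinarith
  have h2 : Real.exp (-M) = Real.exp (-(16 * M / 50)) * Real.exp (-(34 * M / 50)) := by
    rw [← Real.exp_add]; congr 1; ring
  have h3 : Real.exp (-(34 * M / 50)) ≤ Real.exp (C / 50) * Real.exp (-(lam / 50)) := by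
    rw [← Real.exp_add]; exact Real.exp_le_exp.2 (by linarith)
  have h4 : Real.exp (16 * M / 50) * Real.exp (-(16 * M / 50)) = 1 := by
    rw [← Real.exp_add, show 16 * M / 50 + -(16 * M / 50) = 0 by ring, Real.exp_zero]
  have he1 : 0 ≤ Real.exp (-(16 * M / 50)) := (Real.exp_pos _).le
  have he2 : 0 ≤ Real.exp (-(34 * M / 50)) := (Real.exp_pos _).le
  rw [h2]
  calc (1 + M) ^ 2 * (Real.exp (-(16 * M / 50)) * Real.exp (-(34 * M / 50)))
      = ((1 + M) ^ 2 * Real.exp (-(16 * M / 50))) * Real.exp (-(34 * M / 50)) := by ring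
    _ ≤ (40 * Real.exp (16 * M / 50) * Real.exp (-(16 * M / 50))) * Real.exp (-(34 * M / 50)) :=
        mul_le_mul_of_nonneg_right (mul_le_mul_of_nonneg_right h1 he1) he2
    _ = 40 * Real.exp (-(34 * M / 50)) := by rw [mul_assoc 40, h4, mul_one]
    _ ≤ 40 * (Real.exp (C / 50) * Real.exp (-(lam / 50))) := mul_le_mul_of_nonneg_left h3 (by norm_num)
    _ = 40 * Real.exp (C / 50) * Real.exp (-(lam / 50)) := by ring

set_option maxHeartbeats 3200000 in
/-- **The window of Proposition A.3 in `L²` with the printed middle term, for sub-families of blocks and scales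
`Y ∈ [X (log X)^{-1/4}, X]`.**  Unconditionally (the Vinogradov–Korobov region being proved in the tree), there is an
absolute `K > 0` such that for all large `X`, every `0 < η ≤ 1`, every interval system `I : SieveIntervalSystem η X₀`
with `√X ≤ X₀ ≤ X`, every sub-family `𝓙 ⊆ [1, J]` of its blocks, every completely multiplicative `g` with `|g| ≤ 1`,
every scale `Y` with `X ≤ Y (log X)^{1/4}`, `Y ≤ X`, every `t₁` with `𝔻(g, n^{it₁}; X)² ≤ M + 1`, `M = M(g; X)`, and
every `[a, b] ⊆ [t₁ - 2(log X)^{1/16}, t₁ + 2(log X)^{1/16}] ∩ [-X/2, X/2]`,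
`∫_a^b |∑_{Y ≤ n ≤ 2Y, n ∈ 𝒮(𝓙)} g(n) n^{-1-it}|² dt ≤ K (e^{-M} + (log X)^{-1/50})`.
See the module docstring for the proof. [cite: MatomakiRadziwillTao2015, Appendix A, Proposition A.3 (proof)] -/
theorem integral_sq_restr_window_le_exp :
    ∃ K : ℝ, 0 < K ∧ ∀ᶠ X : ℝ in atTop, ∀ (η X₀ : ℝ) (I : SieveIntervalSystem η X₀) (𝓙 : Finset ℕ) (g : ℕ → ℂ),
      0 < η → η ≤ 1 → (∀ m n, g (m * n) = g m * g n) → g 1 = 1 → (∀ n, ‖g n‖ ≤ 1) →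
      Real.sqrt X ≤ X₀ → X₀ ≤ X → 𝓙 ⊆ Finset.Icc 1 I.J →
      ∀ (Y t₁ a b : ℝ), X ≤ Y * Real.log X ^ (1 / 4 : ℝ) → Y ≤ X →
        pretentiousDistSq g (fun n : ℕ => (n : ℂ) ^ ((t₁ : ℂ) * Complex.I)) X ≤ minPretentiousDistSq g X X + 1 →
        a ≤ b → t₁ - 2 * Real.log X ^ (1 / 16 : ℝ) ≤ a → b ≤ t₁ + 2 * Real.log X ^ (1 / 16 : ℝ) →
        -(X / 2) ≤ a → b ≤ X / 2 →
        ∫ t in a..b, ‖∑ n ∈ (Finset.Icc ⌈Y⌉₊ ⌊2 * Y⌋₊).filter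
            (MemBlocks 𝓙 (fun j => (Finset.Icc ⌈I.P j⌉₊ ⌊I.Q j⌋₊).filter Nat.Prime)),
              g n * (n : ℂ) ^ (-(1 + (t : ℂ) * Complex.I))‖ ^ 2 ≤
          K * (Real.exp (-minPretentiousDistSq g X X) + 1 / Real.log X ^ (1 / 50 : ℝ)) := by
  obtain ⟨cVK, hcVK, hVK⟩ := VKZeta.exists_hasVKZeroFreeRegion
  obtain ⟨K₁, Cr, hK₁, hCr0, hSev⟩ := Halasz.Restricted.norm_restr_interval_sum_le_sharp hcVK hVK
  obtain ⟨X₂, hX₂⟩ := Filter.eventually_atTop.mp hSev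
  obtain ⟨K₂, hK₂, hW2⟩ := Halasz.Restricted.norm_restr_interval_sum_le
  set K₃ : ℝ := max K₁ K₂ with hK₃def
  have hK₃ : 0 < K₃ := lt_max_of_lt_left hK₁
  have hK₁₃ : K₁ ≤ K₃ := le_max_left _ _
  have hK₂₃ : K₂ ≤ K₃ := le_max_right _ _
  set Kc : ℝ := 3 * (48 * K₃ + 6) ^ 2 with hKcdef
  have hKc0 : 0 < Kc := by positivity
  set C : ℝ := Cr + 34 * 11 + 1 with hCdef
  have hC0 : 0 ≤ C := by rw [hCdef]; linarith
  set X₂' : ℝ := max X₂ 0 with hX₂'def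
  have hX₂'0 : 0 ≤ X₂' := le_max_right _ _
  refine ⟨Kc * (2 * Real.exp 2 + 240 * Real.exp (C / 50) + 7056), by positivity, ?_⟩
  filter_upwards [eventually_ge_atTop (256 : ℝ), eventually_ge_atTop ((2 * X₂' + 2) ^ 2),
    Real.tendsto_log_atTop.eventually_ge_atTop (256 : ℝ),
    (Real.tendsto_log_atTop.comp Real.tendsto_log_atTop).eventually_ge_atTop (48 : ℝ)] with X hX256 hXX₂ hℓ256 hll
  intro η X₀ I 𝓙 g hη hη1 hg hg1 hgb hX₀ hX₀X h𝓙 Y t₁ a b hYX hYle hmin hab ha hb haX hbX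
  have hη8 : η ≤ 8 := by linarith
  have hX0 : 0 < X := by linarith
  have hX4 : (4 : ℝ) ≤ X := by linarith
  set ℓ : ℝ := Real.log X with hℓdef
  set lam : ℝ := Real.log ℓ with hlamdef
  have hlam48 : 48 ≤ lam := hll
  have hℓ0 : 0 < ℓ := by linarith
  have hℓ1 : 1 ≤ ℓ := by linarith
  have hℓ4 : 4 ≤ ℓ := by linarith
  have hℓ16 : 16 ≤ ℓ := by linarith
  have hlam0 : 0 ≤ lam := by linarith
  have hℓexp : ℓ = Real.exp lam := by rw [hlamdef, Real.exp_log hℓ0]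
  have hlamℓ : lam ≤ 2 * Real.sqrt ℓ := by
    have := Real.log_le_rpow_div hℓ0.le (by norm_num : (0:ℝ) < 1 / 2)
    rw [← Real.sqrt_eq_rpow, ← hlamdef] at this; linarith
  have hsℓ4 : 4 ≤ Real.sqrt ℓ := by
    rw [show (4 : ℝ) = Real.sqrt 16 by rw [show (16:ℝ) = 4 ^ 2 by norm_num, Real.sqrt_sq (by norm_num)]]
    exact Real.sqrt_le_sqrt hℓ16
  have hsqℓℓ : Real.sqrt ℓ ≤ ℓ / 4 := by
    have h := mul_le_mul_of_nonneg_right hsℓ4 (Real.sqrt_nonneg ℓ)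
    rw [Real.mul_self_sqrt hℓ0.le] at h
    linarith
  have hlamℓ' : lam ≤ ℓ / 2 := by linarith
  -- the window length `L = ℓ^{1/16}` and `u = ℓ^{1/4}`
  set L : ℝ := ℓ ^ (1 / 16 : ℝ) with hLdef
  set u : ℝ := ℓ ^ (1 / 4 : ℝ) with hudef
  have hLexp : L = Real.exp (lam / 16) := by
    rw [hLdef, Real.rpow_def_of_pos hℓ0, hlamdef]; ring_nf
  have hlogu : Real.log u = lam / 4 := by
    rw [hudef, Real.log_rpow hℓ0, hlamdef]; ring
  have hu0 : 0 < u := Real.rpow_pos_of_pos hℓ0 _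
  have hu4pow : u ^ 4 = ℓ := by
    rw [hudef, ← Real.rpow_natCast, ← Real.rpow_mul hℓ0.le]; norm_num
  have hu4 : 4 ≤ u := by
    have h1 : (256 : ℝ) ^ (1 / 4 : ℝ) ≤ u := Real.rpow_le_rpow (by norm_num) hℓ256 (by norm_num)
    have h2 : (256 : ℝ) ^ (1 / 4 : ℝ) = 4 := by
      rw [show (256 : ℝ) = (4 : ℝ) ^ (4 : ℕ) by norm_num, ← Real.rpow_natCast, ← Real.rpow_mul (by norm_num)]
      norm_num
    linarith
  have huℓ : 64 * u ≤ ℓ := by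
    have h3 : (64 : ℝ) ≤ u ^ 3 := by
      have h := pow_le_pow_left₀ (by norm_num : (0:ℝ) ≤ 4) hu4 3
      norm_num at h
      exact h
    have h4 : u * u ^ 3 = ℓ := by rw [← hu4pow]; ring
    have h5 := mul_le_mul_of_nonneg_left h3 hu0.le
    linarith
  have hLu : L ≤ u := by
    rw [hLdef, hudef]; exact Real.rpow_le_rpow_of_exponent_le hℓ1 (by norm_num)
  have he3 : (16 : ℝ) ≤ Real.exp 3 := by
    have h := Real.exp_one_gt_d9
    have h3 : Real.exp 3 = Real.exp 1 ^ 3 := by rw [← Real.exp_nat_mul]; norm_num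
    have h4 : (2.7182818283 : ℝ) ^ 3 ≤ Real.exp 1 ^ 3 := pow_le_pow_left₀ (by norm_num) h.le 3
    rw [h3]; exact le_trans (by norm_num) h4
  have h16L : 16 ≤ L := by
    rw [hLexp]; exact he3.trans (Real.exp_le_exp.2 (by linarith))
  have hL0 : 0 < L := by linarith
  have h16L2 : 16 ≤ 2 * L := by linarith
  -- `√X`, `Y`
  have hsX : 0 < Real.sqrt X := Real.sqrt_pos.2 hX0
  have hsX16 : 16 ≤ Real.sqrt X := by
    rw [show (16 : ℝ) = Real.sqrt 256 by rw [show (256:ℝ) = 16 ^ 2 by norm_num, Real.sqrt_sq (by norm_num)]]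
    exact Real.sqrt_le_sqrt hX256
  have hXsq : Real.sqrt X * Real.sqrt X = X := Real.mul_self_sqrt hX0.le
  have hℓX : ℓ ≤ 2 * Real.sqrt X := by
    have h2 : ℓ ≤ X ^ (1 / 2 : ℝ) / (1 / 2) := Real.log_le_rpow_div hX0.le (by norm_num)
    rw [← Real.sqrt_eq_rpow] at h2; linarith
  have huX : 32 * u ≤ Real.sqrt X := by linarith
  have hY4s : 4 * Real.sqrt X ≤ Y := by
    -- `X ≤ Y u ≤ Y √X/32`
    have hY0 : 0 ≤ Y := by
      by_contra hneg
      push Not at hneg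
      have : Y * u < 0 := mul_neg_of_neg_of_pos hneg hu0
      linarith
    have h1 : X ≤ Y * (Real.sqrt X / 32) := hYX.trans (mul_le_mul_of_nonneg_left (by linarith) hY0)
    have h2 : Real.sqrt X * Real.sqrt X ≤ Y / 32 * Real.sqrt X := by rw [hXsq]; linarith
    have h3 : Real.sqrt X ≤ Y / 32 := le_of_mul_le_mul_right h2 hsX
    linarith
  have hY0 : 0 < Y := by linarith
  have hY64 : (64 : ℝ) ≤ Y := by linarith
  have hY2 : Y ≤ 2 * (Y - 1) := by linarith
  have hY1s : Real.sqrt X ≤ Y - 1 := by linarith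
  have hY10 : 0 < Y - 1 := by linarith
  have hLY : 2 * L ≤ Y / 8 := by linarith
  have hY4 : (4 : ℝ) ≤ Y / 4 := by linarith
  have hXY : X / Y ≤ u := by rw [div_le_iff₀ hY0]; linarith
  -- `log Y ≥ ℓ - λ/4`, `log (Y - 1) ≥ ℓ - λ/4 - 1 ≥ ℓ/2`
  have hlogY : ℓ - lam / 4 ≤ Real.log Y := by
    have h1 : Real.log X ≤ Real.log (Y * u) := Real.log_le_log hX0 hYX
    rw [Real.log_mul hY0.ne' hu0.ne', hlogu] at h1
    rw [hℓdef]; linarith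
  have hlogY1 : ℓ - lam / 4 - 1 ≤ Real.log (Y - 1) := by
    have h1 : Real.log (Y / 2) ≤ Real.log (Y - 1) := Real.log_le_log (by linarith) (by linarith)
    rw [Real.log_div hY0.ne' two_ne_zero] at h1
    have h2 := Real.log_two_lt_d9
    linarith
  have hℓ₁ℓ : ℓ / 2 ≤ Real.log (Y - 1) := by linarith
  -- `Q = exp(√ log X)`
  set Q : ℝ := Real.exp (Real.sqrt ℓ) with hQdef
  have hs2 : 2 ≤ Real.sqrt ℓ := by linarith
  have hQ2 : Real.exp 2 ≤ Q := Real.exp_le_exp.2 hs2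
  have hX₀0 : 0 < X₀ := hsX.trans_le hX₀
  have hQJ : I.Q I.J ≤ Q :=
    I.Q_J_le.trans (Real.exp_le_exp.2 (Real.sqrt_le_sqrt (Real.log_le_log hX₀0 hX₀X)))
  have hexpℓ2 : Real.exp (ℓ / 2) = Real.sqrt X := by
    rw [Real.sqrt_eq_rpow, Real.rpow_def_of_pos hX0, hℓdef]; ring_nf
  have hQsX : Q ≤ Real.sqrt X := by
    calc Q ≤ Real.exp (ℓ / 2) := Real.exp_le_exp.2 (by linarith)
      _ = Real.sqrt X := hexpℓ2
  have hQY1 : Q ≤ Y - 1 := hQsX.trans hY1s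
  have hN : I.Q I.J ≤ ((⌈Y⌉₊ - 1 : ℕ) : ℝ) := by
    have h1 : 1 ≤ ⌈Y⌉₊ := Nat.one_le_iff_ne_zero.2 (by simpa using hY0)
    rw [Nat.cast_sub h1, Nat.cast_one]
    have h2 : Y ≤ ⌈Y⌉₊ := Nat.le_ceil Y
    linarith
  set blk : ℕ → Finset ℕ := fun j => (Finset.Icc ⌈I.P j⌉₊ ⌊I.Q j⌋₊).filter Nat.Prime with hblkdef
  have hsys : IsBlockSystem 𝓙 blk (⌈Y⌉₊ - 1) := (isBlockSystem I hη hη8 hN).mono h𝓙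
  have hblkQ : ∀ i ∈ 𝓙, ∀ p ∈ blk i, (p : ℝ) ≤ Q :=
    fun i hi p hp => (primeBlock_le_Q_J I hη hη8 i (h𝓙 hi) p hp).trans hQJ
  -- the threshold `δ₀`
  set δ₀ : ℝ := Real.exp (-(lam / 16 + lam / 100)) with hδ₀def
  have hδ₀ : 0 < δ₀ := Real.exp_pos _
  have hδ₁ : δ₀ ≤ 1 := by rw [hδ₀def]; exact Real.exp_le_one_iff.2 (by linarith)
  -- `M`, `M₀`, the regime flag and the abstract main term `A₀`
  set M : ℝ := minPretentiousDistSq g X X with hMdef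
  have hM0 : 0 ≤ M := minPretentiousDistSq_nonneg hgb X hX0.le
  set M₀ : ℝ := max 0 (M / 2 - 1) with hM₀def
  have hM₀0 : 0 ≤ M₀ := le_max_left _ _
  set B : ℝ := if 34 * M + C ≤ lam then 0 else (1 + M₀) * Real.exp (-M₀) with hBdef
  have hB0 : 0 ≤ B := by
    rw [hBdef]; split_ifs
    · exact le_rfl
    · positivity
  set A₀ : ℝ := Real.exp 1 * Real.exp (-M / 2) + B with hA₀def
  have hA00 : 0 ≤ A₀ := by positivity
  have ht₁T : |t₁| + Y / 4 ≤ X := by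
    have h1 : |t₁| ≤ X / 2 + 2 * L := by rw [abs_le]; constructor <;> linarith
    linarith
  -- the twisted function
  set gt : ℕ → ℂ := fun n => g n * (n : ℂ) ^ (-((t₁ : ℂ) * Complex.I)) with hgt
  have hgt_mul : ∀ m n, gt (m * n) = gt m * gt n := Halasz.Restricted.twist_mul hg t₁
  have hgt_one : gt 1 = 1 := Halasz.Restricted.twist_one hg1 t₁
  have hgt_b : ∀ n, ‖gt n‖ ≤ 1 := Halasz.Restricted.norm_mul_twist_le hgb t₁
  have hlog4 : Real.log 4 < 1.3863 := by
    have : Real.log 4 = 2 * Real.log 2 := by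
      rw [show (4:ℝ) = 2 ^ 2 by norm_num, Real.log_pow]; norm_num
    have h2 := Real.log_two_lt_d9
    linarith
  -- the window bound `hH`
  have hH : ∀ x ν : ℝ, Y - 1 ≤ x → x ≤ 2 * Y → 1 < ν → ν ≤ 2 → δ₀ ≤ ν - 1 → IsBlockSystem 𝓙 blk ⌊ν * x⌋₊ →
      ‖Halasz.S (Halasz.Restricted.restr 𝓙 blk gt ⌊ν * x⌋₊) (ν * x) -
          Halasz.S (Halasz.Restricted.restr 𝓙 blk gt ⌊ν * x⌋₊) x‖ ≤
        K₃ * ((ν - 1) * x * (A₀ + 1 / (Y / 4) + (𝓙.card + 1) * Real.sqrt ((Real.log Q + 2) / Real.log x) +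
            Real.sqrt (Real.log x) / (Y / 4)) +
          (𝓙.card + 1) * x * (ν - 1) ^ (-(1 / 12 : ℝ)) / Real.sqrt (Real.log x) +
          x / Real.log x + x / (Y / 4) + (𝓙.biUnion blk).card) := by
    intro x ν hx1 hx2 hν1 hν2 _ hsysν
    have hx0 : 0 < x := by linarith
    have hx3 : (3 : ℝ) ≤ x := by linarith
    have hxX₂ : X₂ ≤ x := by
      have h1 : X₂ ≤ X₂' := le_max_left _ _
      have h2 : 2 * X₂' + 2 ≤ Real.sqrt X := by
        rw [show 2 * X₂' + 2 = Real.sqrt ((2 * X₂' + 2) ^ 2) by rw [Real.sqrt_sq (by linarith)]]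
        exact Real.sqrt_le_sqrt hXX₂
      linarith
    have hνx : x ≤ ν * x := le_mul_of_one_le_left hx0.le hν1.le
    have hνx1 : 1 < ν * x := by linarith
    have hνx2 : ν * x ≤ 2 * x := mul_le_mul_of_nonneg_right hν2 hx0.le
    have hνx4 : ν * x ≤ 4 * X := by linarith
    have hTx : Y / 4 ≤ ν * x := by linarith
    have hνx0 : 0 ≤ (ν - 1) * x := mul_nonneg (by linarith) hx0.le
    have hlogx : ℓ - lam / 4 - 1 ≤ Real.log x := hlogY1.trans (Real.log_le_log hY10 hx1)
    have hlogx2 : ℓ / 2 ≤ Real.log x := by linarith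
    have hlogx0 : 0 < Real.log x := by linarith
    have hlogνx : Real.log x ≤ Real.log (ν * x) := Real.log_le_log hx0 hνx
    -- the Chebyshev tail at height `νx`: `M ≤ M(g; νx, X) + 1`
    have hMνx : M ≤ minPretentiousDistSq g (ν * x) X + 1 := by
      have h1 := Halasz.Restricted.minPretentiousDistSq_le_height_add hgb hX0.le hνx1 hX0.le (g := g) (T := X)
      -- `2 (log 4) X/(νx log νx) ≤ 1`: `X/(νx) ≤ X/(Y - 1) ≤ 2u`, `log(νx) ≥ ℓ/2`, `64 u ≤ ℓ`
      have hlogνx0 : 0 < Real.log (ν * x) := hlogx0.trans_le hlogνx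
      have hlog4pos : 0 < Real.log 4 := Real.log_pos (by norm_num)
      have h2 : Real.log 4 * X / (ν * x * Real.log (ν * x)) ≤ 1 / 2 := by
        rw [div_le_iff₀ (by positivity)]
        have h3 : X ≤ 2 * u * (ν * x) := by
          have hx2' : Y ≤ 2 * (ν * x) := by linarith
          calc X ≤ u * Y := by linarith
            _ ≤ u * (2 * (ν * x)) := mul_le_mul_of_nonneg_left hx2' hu0.le
            _ = 2 * u * (ν * x) := by ring
        have h5 : 4 * u * Real.log 4 ≤ Real.log (ν * x) := by
          have := mul_le_mul_of_nonneg_left hlog4.le (by positivity : (0:ℝ) ≤ 4 * u)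
          linarith
        calc Real.log 4 * X ≤ Real.log 4 * (2 * u * (ν * x)) := mul_le_mul_of_nonneg_left h3 hlog4pos.le
          _ = (ν * x / 2) * (4 * u * Real.log 4) := by ring
          _ ≤ (ν * x / 2) * Real.log (ν * x) := mul_le_mul_of_nonneg_left h5 (by positivity)
          _ = 1 / 2 * (ν * x * Real.log (ν * x)) := by ring
      rw [hMdef]; linarith
    have hM'ge : M - 1 ≤ minPretentiousDistSq gt (ν * x) (Y / 4) := by
      have h1 : minPretentiousDistSq g (ν * x) X ≤ minPretentiousDistSq gt (ν * x) (Y / 4) :=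
        Halasz.Restricted.minPretentiousDistSq_le_twist hgb (by linarith : (0:ℝ) ≤ Y / 4) ht₁T (ν * x)
      linarith
    have hMhalf : M₀ ≤ minHalfDistSq (𝓙.biUnion blk) gt (ν * x) (Y / 4) := by
      have h1 : minPretentiousDistSq g (ν * x) X / 2 ≤ minHalfDistSq (𝓙.biUnion blk) gt (ν * x) (Y / 4) :=
        Halasz.Restricted.minHalfDistSq_twist_ge_half_min' hgb (𝓙.biUnion blk) (by linarith : (0:ℝ) ≤ Y / 4) ht₁T
          (ν * x)
      have h2 : 0 ≤ minHalfDistSq (𝓙.biUnion blk) gt (ν * x) (Y / 4) :=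
        Halasz.Restricted.minHalfDistSq_nonneg hgt_b (𝓙.biUnion blk) (ν * x) (by linarith : (0:ℝ) ≤ Y / 4)
      refine max_le h2 ?_
      linarith
    -- the error terms are the same in both regimes; the common nonnegativity facts
    have hJ0 : (0 : ℝ) ≤ 𝓙.card + 1 := by
      have := Nat.cast_nonneg (α := ℝ) 𝓙.card; linarith
    have hsq0 : 0 ≤ Real.sqrt ((Real.log Q + 2) / Real.log x) := Real.sqrt_nonneg _
    have hY40 : (0 : ℝ) ≤ Y / 4 := by linarith
    have hsl0 : 0 ≤ Real.sqrt (Real.log x) / (Y / 4) := div_nonneg (Real.sqrt_nonneg _) hY40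
    have hT0' : (0 : ℝ) ≤ 1 / (Y / 4) := div_nonneg zero_le_one hY40
    have hrest0 : 0 ≤ (𝓙.card + 1) * x * (ν - 1) ^ (-(1 / 12 : ℝ)) / Real.sqrt (Real.log x) +
        x / Real.log x + x / (Y / 4) + (𝓙.biUnion blk).card := by
      have h1 : 0 ≤ (𝓙.card + 1) * x * (ν - 1) ^ (-(1 / 12 : ℝ)) / Real.sqrt (Real.log x) := by
        have : 0 ≤ (ν - 1) ^ (-(1 / 12 : ℝ)) := Real.rpow_nonneg (by linarith) _
        exact div_nonneg (mul_nonneg (mul_nonneg hJ0 hx0.le) this) (Real.sqrt_nonneg _)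
      have h2 : 0 ≤ x / Real.log x := div_nonneg hx0.le hlogx0.le
      have h3 : 0 ≤ x / (Y / 4) := div_nonneg hx0.le hY40
      have h4 : (0 : ℝ) ≤ (𝓙.biUnion blk).card := Nat.cast_nonneg _
      linarith
    by_cases hreg : 34 * M + C ≤ lam
    · -- the regime: the sharp window theorem at `(x, T = Y/4, Q, ν)`
      have hlogνx0 : 0 < Real.log (ν * x) := hlogx0.trans_le hlogνx
      have hQle : Q ≤ Real.exp (Real.sqrt (Real.log (ν * x)) + 1) := by
        rw [hQdef]
        refine Real.exp_le_exp.2 (sqrt_le_sqrt_add_one hlogνx0.le ?_)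
        have h1 : Real.sqrt (ℓ / 2) ≤ Real.sqrt (Real.log (ν * x)) := Real.sqrt_le_sqrt (hlogx2.trans hlogνx)
        have h2 : Real.sqrt ℓ ≤ 2 * Real.sqrt (ℓ / 2) := by
          have e1 : 2 * Real.sqrt (ℓ / 2) = Real.sqrt (4 * (ℓ / 2)) := by
            rw [Real.sqrt_mul (by norm_num : (0:ℝ) ≤ 4), show (4:ℝ) = 2 ^ 2 by norm_num,
              Real.sqrt_sq (by norm_num)]
          rw [e1]; exact Real.sqrt_le_sqrt (by linarith)
        linarith
      have hM'le : minPretentiousDistSq gt (ν * x) (Y / 4) ≤ M + 11 := by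
        have h1 : minPretentiousDistSq gt (ν * x) (Y / 4) ≤
            pretentiousDistSq g (fun n : ℕ => (n : ℂ) ^ ((t₁ : ℂ) * Complex.I)) X + 10 :=
          Halasz.Restricted.minPretentiousDistSq_twist_le hgb hX4 hνx4 (by linarith : (0:ℝ) ≤ Y / 4)
        linarith
      have hllx : lam - 1 ≤ Real.log (Real.log x) := by
        have h1 : Real.log (ℓ / 2) ≤ Real.log (Real.log x) := Real.log_le_log (by linarith) hlogx2
        rw [Real.log_div hℓ0.ne' two_ne_zero, ← hlamdef] at h1
        have h2 := Real.log_two_lt_d9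
        linarith
      have hregx : 34 * minPretentiousDistSq gt (ν * x) (Y / 4) + Cr ≤ Real.log (Real.log x) := by
        rw [hCdef] at hreg; linarith
      have h := hX₂ x hxX₂ 𝓙 blk gt hgt_mul hgt_one hgt_b (Y / 4) Q ν hY4 hTx hQ2 hQle hν1 hν2 hsysν hblkQ hregx
      refine h.trans ?_
      have hmain : Real.exp (-(minPretentiousDistSq gt (ν * x) (Y / 4)) / 2) ≤ A₀ := by
        have h1 : Real.exp (-(minPretentiousDistSq gt (ν * x) (Y / 4)) / 2) ≤ Real.exp 1 * Real.exp (-M / 2) := by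
          rw [← Real.exp_add]; exact Real.exp_le_exp.2 (by linarith)
        rw [hA₀def]; linarith
      have hin0 : 0 ≤ A₀ + 1 / (Y / 4) + (𝓙.card + 1) * Real.sqrt ((Real.log Q + 2) / Real.log x) +
          Real.sqrt (Real.log x) / (Y / 4) := by
        have := mul_nonneg hJ0 hsq0; linarith only [hA00, hT0', this, hsl0]
      have hbr : (ν - 1) * x * (Real.exp (-(minPretentiousDistSq gt (ν * x) (Y / 4)) / 2) + 1 / (Y / 4) +
            (𝓙.card + 1) * Real.sqrt ((Real.log Q + 2) / Real.log x) + Real.sqrt (Real.log x) / (Y / 4)) ≤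
          (ν - 1) * x * (A₀ + 1 / (Y / 4) + (𝓙.card + 1) * Real.sqrt ((Real.log Q + 2) / Real.log x) +
            Real.sqrt (Real.log x) / (Y / 4)) :=
        mul_le_mul_of_nonneg_left (by linarith only [hmain]) hνx0
      have hbr₂0 : 0 ≤ (ν - 1) * x * (A₀ + 1 / (Y / 4) +
            (𝓙.card + 1) * Real.sqrt ((Real.log Q + 2) / Real.log x) + Real.sqrt (Real.log x) / (Y / 4)) +
          (𝓙.card + 1) * x * (ν - 1) ^ (-(1 / 12 : ℝ)) / Real.sqrt (Real.log x) +
          x / Real.log x + x / (Y / 4) + (𝓙.biUnion blk).card := by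
        have := mul_nonneg hνx0 hin0; linarith only [this, hrest0]
      calc K₁ * ((ν - 1) * x * (Real.exp (-(minPretentiousDistSq gt (ν * x) (Y / 4)) / 2) + 1 / (Y / 4) +
              (𝓙.card + 1) * Real.sqrt ((Real.log Q + 2) / Real.log x) + Real.sqrt (Real.log x) / (Y / 4)) +
            (𝓙.card + 1) * x * (ν - 1) ^ (-(1 / 12 : ℝ)) / Real.sqrt (Real.log x) +
            x / Real.log x + x / (Y / 4) + (𝓙.biUnion blk).card)
          ≤ K₁ * ((ν - 1) * x * (A₀ + 1 / (Y / 4) +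
              (𝓙.card + 1) * Real.sqrt ((Real.log Q + 2) / Real.log x) + Real.sqrt (Real.log x) / (Y / 4)) +
            (𝓙.card + 1) * x * (ν - 1) ^ (-(1 / 12 : ℝ)) / Real.sqrt (Real.log x) +
            x / Real.log x + x / (Y / 4) + (𝓙.biUnion blk).card) :=
            mul_le_mul_of_nonneg_left (by linarith only [hbr]) hK₁.le
        _ ≤ K₃ * ((ν - 1) * x * (A₀ + 1 / (Y / 4) +
              (𝓙.card + 1) * Real.sqrt ((Real.log Q + 2) / Real.log x) + Real.sqrt (Real.log x) / (Y / 4)) +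
            (𝓙.card + 1) * x * (ν - 1) ^ (-(1 / 12 : ℝ)) / Real.sqrt (Real.log x) +
            x / Real.log x + x / (Y / 4) + (𝓙.biUnion blk).card) :=
            mul_le_mul_of_nonneg_right hK₁₃ hbr₂0
    · -- outside the regime: the unconditional window theorem
      have h := hW2 𝓙 blk gt hgt_mul hgt_one hgt_b x (Y / 4) Q ν hx3 hY4 hQ2 hν1 hν2 hsysν hblkQ
      refine h.trans ?_
      have hBeq : B = (1 + M₀) * Real.exp (-M₀) := by rw [hBdef, if_neg hreg]
      have hmain : (1 + minHalfDistSq (𝓙.biUnion blk) gt (ν * x) (Y / 4)) *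
          Real.exp (-minHalfDistSq (𝓙.biUnion blk) gt (ν * x) (Y / 4)) ≤ A₀ := by
        have h1 := Tao2016.one_add_mul_exp_neg_le hM₀0 hMhalf
        have h2 : 0 ≤ Real.exp 1 * Real.exp (-M / 2) := by positivity
        rw [hA₀def, hBeq]; linarith
      have hin0 : 0 ≤ A₀ + 1 / (Y / 4) + (𝓙.card + 1) * Real.sqrt ((Real.log Q + 2) / Real.log x) +
          Real.sqrt (Real.log x) / (Y / 4) := by
        have := mul_nonneg hJ0 hsq0; linarith only [hA00, hT0', this, hsl0]
      have hbr : (ν - 1) * x * ((1 + minHalfDistSq (𝓙.biUnion blk) gt (ν * x) (Y / 4)) *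
            Real.exp (-minHalfDistSq (𝓙.biUnion blk) gt (ν * x) (Y / 4)) + 1 / (Y / 4) +
            (𝓙.card + 1) * Real.sqrt ((Real.log Q + 2) / Real.log x)) ≤
          (ν - 1) * x * (A₀ + 1 / (Y / 4) + (𝓙.card + 1) * Real.sqrt ((Real.log Q + 2) / Real.log x) +
            Real.sqrt (Real.log x) / (Y / 4)) :=
        mul_le_mul_of_nonneg_left (by linarith only [hmain, hsl0]) hνx0
      have hbr₂0 : 0 ≤ (ν - 1) * x * (A₀ + 1 / (Y / 4) +
            (𝓙.card + 1) * Real.sqrt ((Real.log Q + 2) / Real.log x) + Real.sqrt (Real.log x) / (Y / 4)) +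
          (𝓙.card + 1) * x * (ν - 1) ^ (-(1 / 12 : ℝ)) / Real.sqrt (Real.log x) +
          x / Real.log x + x / (Y / 4) + (𝓙.biUnion blk).card := by
        have := mul_nonneg hνx0 hin0; linarith only [this, hrest0]
      calc K₂ * ((ν - 1) * x * ((1 + minHalfDistSq (𝓙.biUnion blk) gt (ν * x) (Y / 4)) *
              Real.exp (-minHalfDistSq (𝓙.biUnion blk) gt (ν * x) (Y / 4)) + 1 / (Y / 4) +
              (𝓙.card + 1) * Real.sqrt ((Real.log Q + 2) / Real.log x)) +
            (𝓙.card + 1) * x * (ν - 1) ^ (-(1 / 12 : ℝ)) / Real.sqrt (Real.log x) +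
            x / Real.log x + x / (Y / 4) + (𝓙.biUnion blk).card)
          ≤ K₂ * ((ν - 1) * x * (A₀ + 1 / (Y / 4) +
              (𝓙.card + 1) * Real.sqrt ((Real.log Q + 2) / Real.log x) + Real.sqrt (Real.log x) / (Y / 4)) +
            (𝓙.card + 1) * x * (ν - 1) ^ (-(1 / 12 : ℝ)) / Real.sqrt (Real.log x) +
            x / Real.log x + x / (Y / 4) + (𝓙.biUnion blk).card) :=
            mul_le_mul_of_nonneg_left (by linarith only [hbr]) hK₂.le
        _ ≤ K₃ * ((ν - 1) * x * (A₀ + 1 / (Y / 4) +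
              (𝓙.card + 1) * Real.sqrt ((Real.log Q + 2) / Real.log x) + Real.sqrt (Real.log x) / (Y / 4)) +
            (𝓙.card + 1) * x * (ν - 1) ^ (-(1 / 12 : ℝ)) / Real.sqrt (Real.log x) +
            x / Real.log x + x / (Y / 4) + (𝓙.biUnion blk).card) :=
            mul_le_mul_of_nonneg_right hK₂₃ hbr₂0
  -- Gallagher: the block-level bound over the window `[t₁ - 2L, t₁ + 2L]`
  have hmainI := Halasz.Restricted.integral_sq_restr_dirichlet_window_sq_le_of_const hK₃ hA00 𝓙 blk g hg hg1 hgb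
    hY64 h16L2 hLY hδ₀ hδ₁ hQ2 hsys hH
  have hcont : Continuous fun t : ℝ => ‖∑ n ∈ (Finset.Icc ⌈Y⌉₊ ⌊2 * Y⌋₊).filter (MemBlocks 𝓙 blk),
      g n * (n : ℂ) ^ (-(1 + (t : ℂ) * Complex.I))‖ ^ 2 :=
    ((continuous_finsetSum _ fun n _ => continuous_const.mul (continuous_natCast_cpow_neg n)).norm).pow 2
  have hmono : ∫ t in a..b, ‖∑ n ∈ (Finset.Icc ⌈Y⌉₊ ⌊2 * Y⌋₊).filter (MemBlocks 𝓙 blk),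
        g n * (n : ℂ) ^ (-(1 + (t : ℂ) * Complex.I))‖ ^ 2 ≤
      ∫ t in (t₁ - 2 * L)..(t₁ + 2 * L), ‖∑ n ∈ (Finset.Icc ⌈Y⌉₊ ⌊2 * Y⌋₊).filter (MemBlocks 𝓙 blk),
        g n * (n : ℂ) ^ (-(1 + (t : ℂ) * Complex.I))‖ ^ 2 := by
    refine intervalIntegral.integral_mono_interval ha hab hb
      (Filter.Eventually.of_forall fun t => by positivity) ?_
    exact hcont.intervalIntegrable _ _
  refine hmono.trans (hmainI.trans ?_)
  clear hmainI hmono hH hcont hsys hblkQ hN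
  rw [← hKcdef]
  -- the error terms (the tree's bookkeeping `windowSq_errTerms_le`, used once and doubled)
  set ℓ₁ : ℝ := Real.log (Y - 1) with hℓ₁def
  set Jr : ℝ := (𝓙.card : ℝ) + 1 with hJrdef
  set ρ₁ : ℝ := Real.sqrt ((Real.log Q + 2) / ℓ₁) with hρ₁def
  set s : ℝ := 1 / Real.sqrt ℓ₁ with hsdef
  set c : ℝ := 2 * L / ℓ₁ with hcdef
  set d : ℝ := 2 * L * ((𝓙.biUnion blk).card + 15) / Y with hddef
  set d' : ℝ := 2 * L * Real.sqrt (Real.log (2 * Y)) / Y with hd'def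
  have hℓ₁0 : 0 < ℓ₁ := by rw [hℓ₁def]; linarith
  have hℓ₁ℓ' : ℓ / 2 ≤ ℓ₁ := hℓ₁ℓ
  have hJr0 : 0 ≤ Jr := by
    have : (0 : ℝ) ≤ 𝓙.card := Nat.cast_nonneg _
    rw [hJrdef]; linarith
  have hJr : Jr ≤ 3 + lam := by
    have hcard : (𝓙.card : ℝ) ≤ I.J := by
      have h1 : 𝓙.card ≤ (Finset.Icc 1 I.J).card := Finset.card_le_card h𝓙
      rw [Nat.card_Icc] at h1
      have h2 : ((𝓙.card : ℕ) : ℝ) ≤ ((I.J + 1 - 1 : ℕ) : ℝ) := by exact_mod_cast h1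
      simpa using h2
    have hexp2 : Real.exp 1 ^ 2 ≤ X :=
      le_trans (le_trans (pow_le_pow_left₀ (Real.exp_pos 1).le Real.exp_one_lt_d9.le 2) (by norm_num)) hX256
    have he1 : Real.exp 1 ≤ X₀ := by
      refine le_trans ?_ hX₀
      rw [← Real.sqrt_sq (Real.exp_pos 1).le]
      exact Real.sqrt_le_sqrt hexp2
    have h1 := J_add_one_le I hη hη1 he1
    have h2 : Real.log (Real.log X₀) ≤ lam := by
      have hX₀1 : 1 ≤ Real.log X₀ := by
        rw [← Real.log_exp 1]; exact Real.log_le_log (Real.exp_pos 1) he1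
      exact Real.log_le_log (by linarith) (Real.log_le_log hX₀0 hX₀X)
    rw [hJrdef]; linarith
  have hρ₀ : 0 ≤ ρ₁ := Real.sqrt_nonneg _
  have hρ : ρ₁ ≤ 2 * Real.exp (-(lam / 4)) := by
    have h1 : (Real.log Q + 2) / ℓ₁ ≤ 2 * ((Real.sqrt ℓ + 2) / ℓ) := by
      rw [hQdef, Real.log_exp, div_le_iff₀ hℓ₁0]
      have h0 : 0 ≤ Real.sqrt ℓ + 2 := by positivity
      have e : 2 * ((Real.sqrt ℓ + 2) / ℓ) * ℓ₁ = (Real.sqrt ℓ + 2) * (2 * ℓ₁ / ℓ) := by ring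
      rw [e]
      have : 1 ≤ 2 * ℓ₁ / ℓ := by rw [le_div_iff₀ hℓ0]; linarith
      exact le_mul_of_one_le_right h0 this
    have h2 := sqrt_ratio_le hℓ4
    rw [← hlamdef] at h2
    calc ρ₁ ≤ Real.sqrt (2 * ((Real.sqrt ℓ + 2) / ℓ)) := Real.sqrt_le_sqrt h1
      _ = Real.sqrt 2 * Real.sqrt ((Real.sqrt ℓ + 2) / ℓ) := Real.sqrt_mul (by norm_num) _
      _ ≤ Real.sqrt 2 * (Real.sqrt 2 * Real.exp (-(lam / 4))) :=
          mul_le_mul_of_nonneg_left h2 (Real.sqrt_nonneg _)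
      _ = 2 * Real.exp (-(lam / 4)) := by
          rw [← mul_assoc, Real.mul_self_sqrt (by norm_num)]
  have hs0 : 0 ≤ s := by positivity
  have hsℓ : Real.sqrt ℓ = Real.exp (lam / 2) := by
    rw [hℓexp, Real.sqrt_eq_rpow, ← Real.exp_mul]; ring_nf
  have hs : s ≤ Real.sqrt 2 * Real.exp (-(lam / 2)) := by
    have h1 : Real.sqrt (ℓ / 2) ≤ Real.sqrt ℓ₁ := Real.sqrt_le_sqrt hℓ₁ℓ'
    have h2 : s ≤ 1 / Real.sqrt (ℓ / 2) :=
      one_div_le_one_div_of_le (Real.sqrt_pos.2 (by linarith)) h1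
    have h3 : 1 / Real.sqrt (ℓ / 2) = Real.sqrt 2 * Real.exp (-(lam / 2)) := by
      rw [Real.sqrt_div' ℓ (by norm_num : (0:ℝ) ≤ 2), hsℓ, Real.exp_neg]
      field_simp
    linarith [h3 ▸ h2]
  have hc2 : c / 2 ≤ 2 * Real.exp (-(15 / 16 * lam)) := by
    have e0 : c / 2 = L / ℓ₁ := by rw [hcdef]; ring
    rw [e0, hLexp, div_le_iff₀ hℓ₁0]
    have e : Real.exp (lam / 16) = 2 * Real.exp (-(15 / 16 * lam)) * (Real.exp lam / 2) := by
      rw [show (lam / 16) = -(15 / 16 * lam) + lam by ring, Real.exp_add]; ring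
    rw [e, ← hℓexp]
    exact mul_le_mul_of_nonneg_left hℓ₁ℓ' (by positivity)
  have hEcard : ((𝓙.biUnion blk).card : ℝ) ≤ Q := by
    have h1 : 𝓙.biUnion blk ⊆ (Finset.Icc 1 I.J).biUnion blk := Finset.biUnion_subset_biUnion_of_subset_left blk h𝓙
    have h2 : ((𝓙.biUnion blk).card : ℝ) ≤ ((Finset.Icc 1 I.J).biUnion blk).card := by
      exact_mod_cast Finset.card_le_card h1
    exact h2.trans ((card_biUnion_primeBlock_le I hη hη8).trans hQJ)
  have hXexp : X = Real.exp ℓ := by rw [hℓdef, Real.exp_log hX0]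
  have hQuX : Q * u / X ≤ Real.exp (-lam) := by
    -- `Q u / X = exp(√ℓ + λ/4 - ℓ) ≤ exp(-λ)` since `√ℓ + (5/4)λ ≤ √ℓ + (5/2)√ℓ ≤ ℓ`
    have hueq : u = Real.exp (lam / 4) := by
      rw [hudef, Real.rpow_def_of_pos hℓ0, hlamdef]; ring_nf
    rw [hXexp, hQdef, hueq, ← Real.exp_add, ← Real.exp_sub]
    refine Real.exp_le_exp.2 ?_
    linarith only [hsqℓℓ, hlamℓ', hℓ0]
  have hdd2 : (d + d') / 2 ≤ 4 * Real.exp (-(15 / 16 * lam)) := by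
    have hsq : Real.sqrt (Real.log (2 * Y)) ≤ Q := by
      have h1 : Real.log (2 * Y) ≤ 2 * ℓ := by
        have : Real.log (2 * Y) ≤ Real.log (2 * X) := Real.log_le_log (by linarith) (by linarith)
        rw [Real.log_mul (by norm_num) hX0.ne', ← hℓdef] at this
        have := Real.log_two_lt_d9; linarith
      have h2 : Real.sqrt (Real.log (2 * Y)) ≤ Real.sqrt 2 * Real.sqrt ℓ := by
        rw [← Real.sqrt_mul (by norm_num)]; exact Real.sqrt_le_sqrt h1
      have h3 : Real.sqrt 2 ≤ 2 := by rw [Real.sqrt_le_left (by norm_num)]; norm_num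
      have h4 : Real.sqrt ℓ ≤ Real.exp (Real.sqrt ℓ) / 2 := by
        have hq := Real.quadratic_le_exp_of_nonneg (Real.sqrt_nonneg ℓ)
        rw [Real.sq_sqrt hℓ0.le] at hq
        linarith only [hq, hsqℓℓ, hℓ0]
      calc Real.sqrt (Real.log (2 * Y)) ≤ Real.sqrt 2 * Real.sqrt ℓ := h2
        _ ≤ 2 * Real.sqrt ℓ := mul_le_mul_of_nonneg_right h3 (Real.sqrt_nonneg ℓ)
        _ ≤ Real.exp (Real.sqrt ℓ) := by linarith
        _ = Q := by rw [hQdef]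
    have hQ15 : (15 : ℝ) ≤ 2 * Q := by
      have hq := Real.quadratic_le_exp_of_nonneg (by norm_num : (0:ℝ) ≤ 4)
      have h4Q : Real.exp 4 ≤ Q := Real.exp_le_exp.2 hsℓ4
      norm_num at hq
      linarith only [hq, h4Q]
    have h1 : (d + d') / 2 ≤ L * (4 * Q) / Y := by
      have e : (d + d') / 2 = L * (((𝓙.biUnion blk).card : ℝ) + 15 + Real.sqrt (Real.log (2 * Y))) / Y := by
        rw [hddef, hd'def]; ring
      rw [e]
      refine div_le_div_of_nonneg_right (mul_le_mul_of_nonneg_left ?_ hL0.le) hY0.le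
      linarith
    have hQ0 : 0 < Q := Real.exp_pos _
    have h2 : Q / Y ≤ Real.exp (-lam) := by
      have : Q / Y ≤ Q * u / X := by
        rw [div_le_div_iff₀ hY0 hX0]
        have h := mul_le_mul_of_nonneg_left hYX hQ0.le
        linarith only [h]
      exact this.trans hQuX
    calc (d + d') / 2 ≤ L * (4 * Q) / Y := h1
      _ = 4 * L * (Q / Y) := by ring
      _ ≤ 4 * L * Real.exp (-lam) := mul_le_mul_of_nonneg_left h2 (by positivity)
      _ = 4 * Real.exp (-(15 / 16 * lam)) := by
          rw [hLexp, mul_assoc, ← Real.exp_add]; congr 1; congr 1; ring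
  have herr := windowSq_errTerms_le hlam0 hJr hρ₀ hρ hs0 hs hc2 hdd2
  -- `G = 2 (the tree's sum) - Jr ρ₁ ≤ 84 e^{-λ/100}`
  have hGeq : Jr * ρ₁ + Jr * (2 * L) * δ₀ ^ (-(1 / 12 : ℝ)) / Real.sqrt ℓ₁ + c + d + 2 * L * δ₀ + d' =
      2 * (Jr * ρ₁ + Jr * Real.exp (lam / 16) * (Real.exp (-(lam / 16 + lam / 100))) ^ (-(1 / 12 : ℝ)) * s +
        c / 2 + (d + d') / 2 + Real.exp (lam / 16) * Real.exp (-(lam / 16 + lam / 100))) - Jr * ρ₁ := by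
    rw [hsdef, hδ₀def, hLexp]; ring
  have hG0 : 0 ≤ Jr * ρ₁ + Jr * (2 * L) * δ₀ ^ (-(1 / 12 : ℝ)) / Real.sqrt ℓ₁ + c + d + 2 * L * δ₀ + d' := by
    have h1 : 0 ≤ Jr * ρ₁ := mul_nonneg hJr0 hρ₀
    have h2 : 0 ≤ Jr * (2 * L) * δ₀ ^ (-(1 / 12 : ℝ)) / Real.sqrt ℓ₁ :=
      div_nonneg (mul_nonneg (mul_nonneg hJr0 (by linarith)) (Real.rpow_nonneg hδ₀.le _)) (Real.sqrt_nonneg _)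
    have h3 : 0 ≤ c := by rw [hcdef]; exact div_nonneg (by linarith) hℓ₁0.le
    have h4 : 0 ≤ d := by
      rw [hddef]
      exact div_nonneg (mul_nonneg (by linarith) (add_nonneg (Nat.cast_nonneg _) (by norm_num))) hY0.le
    have h5 : 0 ≤ 2 * L * δ₀ := mul_nonneg (by linarith) hδ₀.le
    have h6 : 0 ≤ d' := by rw [hd'def]; positivity
    linarith
  have hGle : Jr * ρ₁ + Jr * (2 * L) * δ₀ ^ (-(1 / 12 : ℝ)) / Real.sqrt ℓ₁ + c + d + 2 * L * δ₀ + d' ≤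
      84 * Real.exp (-(lam / 100)) := by
    rw [hGeq]
    have : 0 ≤ Jr * ρ₁ := mul_nonneg hJr0 hρ₀
    linarith
  have hE2 : 1 / ℓ ^ (1 / 50 : ℝ) = Real.exp (-(lam / 50)) := by
    rw [Real.rpow_def_of_pos hℓ0, one_div, ← Real.exp_neg, hlamdef]; ring_nf
  have hGsq : (Jr * ρ₁ + Jr * (2 * L) * δ₀ ^ (-(1 / 12 : ℝ)) / Real.sqrt ℓ₁ + c + d + 2 * L * δ₀ + d') ^ 2 ≤
      7056 * (1 / ℓ ^ (1 / 50 : ℝ)) := by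
    have h1 := pow_le_pow_left₀ hG0 hGle 2
    have hE1 : Real.exp (-(lam / 100)) ^ 2 = Real.exp (-(lam / 50)) := by
      rw [← Real.exp_nat_mul]; congr 1; push_cast; ring
    have hE : (84 * Real.exp (-(lam / 100))) ^ 2 = 7056 * (1 / ℓ ^ (1 / 50 : ℝ)) := by
      rw [mul_pow, hE1, hE2]; norm_num
    rw [← hE]; exact h1
  -- the main term squared: `A₀² ≤ 2 e² e^{-M} + 2 B²`, `B² ≤ 120 e^{C/50} ℓ^{-1/50}`
  have hB2 : B ^ 2 ≤ 120 * Real.exp (C / 50) * (1 / ℓ ^ (1 / 50 : ℝ)) := by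
    rw [hBdef]
    split_ifs with h
    · have : 0 ≤ 120 * Real.exp (C / 50) * (1 / ℓ ^ (1 / 50 : ℝ)) := by positivity
      simpa using this
    · have h1 := sq_peak_le hM0
      rw [← hM₀def] at h1
      have h2 := sq_mul_exp_neg_le_of_not_regime hM0 h (C := C) (lam := lam)
      rw [hE2]
      linarith only [h1, h2]
  have hA₀sq : A₀ ^ 2 ≤ 2 * (Real.exp 2 * Real.exp (-M)) + 2 * B ^ 2 := by
    have e1 : (Real.exp 1 * Real.exp (-M / 2)) ^ 2 = Real.exp 2 * Real.exp (-M) := by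
      rw [mul_pow, ← Real.exp_nat_mul, ← Real.exp_nat_mul]
      congr 1 <;> (congr 1; push_cast; ring)
    rw [hA₀def, ← e1]
    nlinarith only [sq_nonneg (Real.exp 1 * Real.exp (-M / 2) - B)]
  -- assemble
  have hiE : 0 ≤ 1 / ℓ ^ (1 / 50 : ℝ) := div_nonneg zero_le_one (Real.rpow_nonneg hℓ0.le _)
  have heM0 : 0 ≤ Real.exp (-M) := (Real.exp_pos _).le
  have heC : 0 ≤ Real.exp (C / 50) := (Real.exp_pos _).le
  calc Kc * (A₀ ^ 2 + (Jr * ρ₁ + Jr * (2 * L) * δ₀ ^ (-(1 / 12 : ℝ)) / Real.sqrt ℓ₁ + c + d + 2 * L * δ₀ + d') ^ 2)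
      ≤ Kc * ((2 * (Real.exp 2 * Real.exp (-M)) + 2 * (120 * Real.exp (C / 50) * (1 / ℓ ^ (1 / 50 : ℝ)))) +
          7056 * (1 / ℓ ^ (1 / 50 : ℝ))) := by
        refine mul_le_mul_of_nonneg_left ?_ hKc0.le
        linarith
    _ = Kc * (2 * Real.exp 2) * Real.exp (-M) + Kc * (240 * Real.exp (C / 50) + 7056) * (1 / ℓ ^ (1 / 50 : ℝ)) := by
        ring
    _ ≤ Kc * (2 * Real.exp 2 + 240 * Real.exp (C / 50) + 7056) * (Real.exp (-M) + 1 / ℓ ^ (1 / 50 : ℝ)) := by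
        have h1 : 0 ≤ Kc * (240 * Real.exp (C / 50) + 7056) * Real.exp (-M) := by positivity
        have h2 : 0 ≤ Kc * (2 * Real.exp 2) * (1 / ℓ ^ (1 / 50 : ℝ)) := by positivity
        linarith only [h1, h2]

end MRT2015

end Literature.NumberTheory.LFunctions
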